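import Mathlib
import HarnessLib
import Summits.Langlands.Langlands.Theses.HolomorphicShadow

/-!
# Birth skeleton (BC3) for crux stmt-Langlands-11630
`Summit.Langlands.Langlands.Theses.HolomorphicShadow.ShadowConverse` — line `birth`

Route `route-Langlands-HolomorphicShadow` (`closes : ShadowModularity → ShadowConverse → SectorComplement →
Langlands`; this crux is `hSC`, rank 3). THE CRUX (Berezin form of card K1): for `N ∣ L`, `χ mod N`, `ψ mod L`,
`ε = ±1`, `‖a_n‖ ≤ C(n+1)^A` and any `k₀` — if for every `k ≥ k₀` and every `g ∈ S_k(Γ₀(L), ψ)` (four-clause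
sense) the typed shadow `H_(a,ε,g) = Σ c_m q^m` converges and lies in `S_k(Γ₀(L), χψ)`, then the Maass lift
`φ_(a,ε)(z) = Σ a_n √y K₀(2πny)(e(nx) + ε e(-nx))` satisfies `φ(γz) = χ(d_γ) φ(z)` on `Γ₀(L)`.

This file concludes the crux BY NAME from five named stubs along the route's own two-layer plan
(`ShadowConverse ⇐ [StripUnfolding] → [SymbolCovariance + off-diagonal decay at non-elliptic points] →
[BerezinLocalization]`) and the refuters' §6 proof skeleton (shadow = weight-`k` strip/Bergman projection of
`φ_a·g`; covariance; Berezin localisation), with the two facts that make the line a statement about TOEPLITZ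
OPERATORS WITH A PERIODIC SYMBOL made explicit: the argument uses nothing about `φ_(a,ε)` except continuity,
`1`-periodicity and two-sided polynomial growth (STUB 1), and nothing about the typed coefficients `c_m` except
that they ARE Sturm's strip-projection coefficients of `φ_(a,ε)·g` (STUB 2).

* `stub_maassLiftSymbol` (M/L, true analysis) — `φ_(a,ε)` is an ADMISSIBLE SYMBOL: continuous, `φ(Tz) = φ(z)`,
  `‖φ(z)‖ ≤ C'(y^{A'} + y^{-A'})` (from `K₀(x) ≤ e^{-x}√(π/2x)`).
* `stub_shadowCoeff_eq_stripCoeff` (L, true analysis) — STURM–LIPSCHITZ UNFOLDING: from some weight `k₁(A)` on,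
  `coeff a ε k b m = P_k(φ_(a,ε), g)_m := (4πm)^{k-1}/Γ(k-1) ∫_0^∞∫_0^1 φ g e^{-2πimx} dx e^{-2πmy} y^{k-2} dy`
  for every `g = Σ b_m q^m` of the four-clause class and every `m ≥ 1` (orthogonality in `x` picks
  `m' = m ∓ n`, the `y`-integral is the typed `Ik`; Fubini at `k > 2A + 6`).
* `stub_covariantSymbol` (XL, THE HEART and the risk) — for an admissible symbol whose strip shadows against
  `S_k(Γ₀(L), ψ)` are cusp forms of character `χψ` from `k₀` on, there are weights `k_j → ∞` and EXACTLY
  `χ`-covariant functions `σ_j` (`σ_j(γz) = χ(d_γ)σ_j(z)` on `Γ₀(L)`) with `σ_j - B_{k_j}φ → 0` at every FREE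
  point (intended: the normalised covariant symbol `(A_k K^ψ_z)(z)/K^ψ_z(z)` of the shadow operator
  `g ↦ P_k(φ g)`; covariance is exact algebra, the identity-coset term of the periodised Bergman seed is the
  Berezin transform, the off-diagonal `Γ_∞\Γ₀(L)` terms must tend to `0` — the route's recorded why-might-fail).
* `stub_berezinLocalization` (L, provable now) — the route's support item `BerezinLocalization`
  (stmt-Langlands-11635) BY NAME: `B_k φ → φ` pointwise for continuous `φ` of two-sided polynomial growth.
* `stub_freePointsDense` (M, true geometry) — points of `ℍ` whose `Γ₀(L)`-stabiliser acts trivially are dense.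
* `ShadowConverse_of : stubs 1–5 → ShadowConverse` — kernel-checked, no `sorry`: transport the crux hypothesis
  to strip-shadow modularity of `φ = φ_(a,ε)` from `max k₀ k₁` on (STUBS 1–2; `shadow = qSeries ∘ coeff` is
  `rfl`), get `σ_j` (STUB 3) and `B_{k_j}φ → φ` (STUB 4), conclude `φ(γw) = χ(d)φ(w)` at free `w` by uniqueness
  of limits (free points are `Γ₀(L)`-stable: `isFreePoint_smul`), then everywhere by density (STUB 5), continuity
  of `φ` and of `w ↦ γ•w`, and closedness of an equaliser.

Shape (for `ledger skeleton check` / `#h21_check_skeleton`): stubs are `theorem stub_<name> (binders) : <goal> :=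
by sorry`; `_Goal.stub_<name> : Prop := type_of% @stub_<name>` names each statement; the composition takes
`(h₁ : _Goal.stub_maassLiftSymbol) … (h₅ : _Goal.stub_freePointsDense)` and concludes the route decl by name; the
final `example` feeds the five stubs to it. Sorries: exactly the five stubs.

Disproof used: none relevant — the crux has no `Disproof.lean` / Negative lemma (`ledger crux ls
stmt-Langlands-11630`: no workfiles before this one; `ledger negatives --problem Langlands` does not touch this
line). Honoured instead: the refuters' crux-attack findings (CruxAttack_ShadowConverse.md,
Evidence_ShadowConverse.md): `ε = ±1` is not used by the argument (stubs 1–2 hold for any `ε`), `0 < N` is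
redundant given `N ∣ L`, `0 < L`, the degenerate cases (`χ(-1) = -1`, parity of `ψ`) force `φ = 0`
consistently (stub 3 then forces `σ_j = 0`, hence `B_{k_j}φ → 0` at free points), and the `k → ∞` limit is
taken along a weight sequence `k_j` chosen by the prover (the parity class of `ψ`), never uniformly in `z`.
-/

set_option linter.dupNamespace false

noncomputable section

namespace Summit.Langlands.Langlands.Cruxes.ShadowConverse.Birth

open Summit.Langlands.Langlands.Theses.HolomorphicShadow
open scoped BigOperators Topology Manifold Classical MeasureTheory ProbabilityTheory Matrix InnerProductSpace ComplexConjugate ContinuousMap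
open Filter Set Function TopologicalSpace MeasureTheory

/-! ## 0. Named copies of the crux's `let` gadgets (verbatim; `shadowConverse_iff` is `Iff.rfl`) -/

/-- `K₀(x) = ∫_0^∞ e^{-x cosh t} dt` (the crux's `K0`). -/
def K0 (x : ℝ) : ℝ := ∫ t in Set.Ioi (0 : ℝ), Real.exp (-(x * Real.cosh t))

/-- The Maass lift `φ_(a,ε)(z) = Σ_{n≥1} a_n √y K₀(2πny) (e(nx) + ε e(-nx))` (the crux's `maass`). -/
def maass (a : ℕ → ℂ) (ε : ℂ) (z : UpperHalfPlane) : ℂ :=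
  ∑' n : ℕ, a (n + 1) * ((Real.sqrt z.im * K0 (2 * Real.pi * ((n : ℝ) + 1) * z.im) : ℝ) : ℂ) *
    (Complex.exp (2 * Real.pi * Complex.I * ((n : ℂ) + 1) * (z.re : ℂ)) +
      ε * Complex.exp (-(2 * Real.pi * Complex.I * ((n : ℂ) + 1) * (z.re : ℂ))))

/-- The crux's four-clause cusp-form predicate `IsCusp k L ω g b`: `g = Σ_{m≥1} b_m q^m`, holomorphic,
`g(γz) = ω(d_γ)(c_γ z + d_γ)^k g(z)` on `Γ₀(L)`, `y^{k/2}|g|` bounded. -/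
@[folklore] def IsCusp (k L : ℕ) (ω : ℤ → ℂ) (g : UpperHalfPlane → ℂ) (b : ℕ → ℂ) : Prop :=
  (∀ z : UpperHalfPlane, HasSum (fun m : ℕ => b (m + 1) * Complex.exp (2 * Real.pi * Complex.I * ((m : ℂ) + 1) * (z : ℂ))) (g z)) ∧ MDifferentiable (modelWithCornersSelf ℂ ℂ) (modelWithCornersSelf ℂ ℂ) g ∧ (∀ γ ∈ CongruenceSubgroup.Gamma0 L, ∀ z : UpperHalfPlane, g (γ • z) = ω ((γ : Matrix (Fin 2) (Fin 2) ℤ) 1 1) * ((((γ : Matrix (Fin 2) (Fin 2) ℤ) 1 0 : ℤ) : ℂ) * (z : ℂ) + (((γ : Matrix (Fin 2) (Fin 2) ℤ) 1 1 : ℤ) : ℂ)) ^ k * g z) ∧ ∃ C : ℝ, ∀ z : UpperHalfPlane, z.im ^ ((k : ℝ) / 2) * ‖g z‖ ≤ C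

/-- The crux's `y`-integral `I_k(m,m') = ∫_0^∞ y^{k-3/2} K₀(2π|m-m'|y) e^{-2π(m+m')y} dy`. -/
def Ik (k m m' : ℕ) : ℝ :=
  ∫ y in Set.Ioi (0 : ℝ), y ^ ((k : ℝ) - 3 / 2) * K0 (2 * Real.pi * |(m : ℝ) - (m' : ℝ)| * y) * Real.exp (-(2 * Real.pi * ((m : ℝ) + (m' : ℝ)) * y))

/-- The crux's shifted-convolution summand `term a ε k b m m'`. -/
def term (a : ℕ → ℂ) (ε : ℂ) (k : ℕ) (b : ℕ → ℂ) (m m' : ℕ) : ℂ :=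
  if m' = 0 ∨ m' = m then 0 else (if m' < m then a (m - m') else ε * a (m' - m)) * b m' * ((Ik k m m' : ℝ) : ℂ)

/-- The crux's shadow coefficient `c_m = (4πm)^{k-1}/Γ(k-1) · Σ_{m'} term`. -/
def coeff (a : ℕ → ℂ) (ε : ℂ) (k : ℕ) (b : ℕ → ℂ) (m : ℕ) : ℂ :=
  (((4 * Real.pi * (m : ℝ)) ^ (k - 1) / Real.Gamma ((k : ℝ) - 1) : ℝ) : ℂ) * ∑' m' : ℕ, term a ε k b m m'

/-- The crux's shadow `H_(a,ε,g) = Σ_{m≥1} c_m q^m`. -/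
def shadow (a : ℕ → ℂ) (ε : ℂ) (k : ℕ) (b : ℕ → ℂ) (z : UpperHalfPlane) : ℂ :=
  ∑' m : ℕ, coeff a ε k b (m + 1) * Complex.exp (2 * Real.pi * Complex.I * ((m : ℂ) + 1) * (z : ℂ))

/-- The crux's `ShadowInS a ε k b L ω`: the shadow series converge and the shadow is a cusp form of
character `ω`. -/
@[folklore] def ShadowInS (a : ℕ → ℂ) (ε : ℂ) (k : ℕ) (b : ℕ → ℂ) (L : ℕ) (ω : ℤ → ℂ) : Prop :=
  (∀ m : ℕ, Summable (term a ε k b m)) ∧ IsCusp k L ω (shadow a ε k b) (coeff a ε k b)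

/-- The crux unfolded over the named gadgets (definitional). -/
theorem shadowConverse_iff : ShadowConverse ↔
    ∀ (N L : ℕ) (χ : DirichletCharacter ℂ N) (ψ : DirichletCharacter ℂ L) (ε : ℂ) (a : ℕ → ℂ) (k₀ : ℕ),
      0 < N → N ∣ L → 0 < L → (ε = 1 ∨ ε = -1) → (∃ C A : ℝ, ∀ n : ℕ, ‖a n‖ ≤ C * ((n : ℝ) + 1) ^ A) →
      (∀ k : ℕ, k₀ ≤ k → ∀ (b : ℕ → ℂ) (g : UpperHalfPlane → ℂ),
        IsCusp k L (fun d : ℤ => ψ (d : ZMod L)) g b →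
          ShadowInS a ε k b L (fun d : ℤ => χ (d : ZMod N) * ψ (d : ZMod L))) →
      ∀ γ ∈ CongruenceSubgroup.Gamma0 L, ∀ z : UpperHalfPlane,
        maass a ε (γ • z) = χ ((((γ : Matrix (Fin 2) (Fin 2) ℤ) 1 1 : ℤ) : ZMod N)) * maass a ε z :=
  Iff.rfl

/-! ## 1. The line's own objects: strip projection, Berezin transform, admissible symbols, free points -/

/-- The `q`-series with coefficients `c` (no constant term): `Σ_{m≥1} c_m e(mz)`; `shadow a ε k b` is
`qSeries (coeff a ε k b)` by `rfl`. -/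
def qSeries (c : ℕ → ℂ) (z : UpperHalfPlane) : ℂ :=
  ∑' m : ℕ, c (m + 1) * Complex.exp (2 * Real.pi * Complex.I * ((m : ℂ) + 1) * (z : ℂ))

theorem shadow_eq_qSeries (a : ℕ → ℂ) (ε : ℂ) (k : ℕ) (b : ℕ → ℂ) :
    shadow a ε k b = qSeries (coeff a ε k b) := rfl

/-- STURM'S STRIP-PROJECTION COEFFICIENT of `F = φ·g` in weight `k` (Sturm 1980, Thm 1, the formula for
`c(n)`; here for an ARBITRARY symbol `φ`, no automorphy assumed):
`P_k(φ,g)_m = (4πm)^{k-1}/Γ(k-1) · ∫_0^∞ (∫_0^1 φ(x+iy) g(x+iy) e^{-2πimx} dx) e^{-2πmy} y^{k-2} dy`,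
i.e. the `m`-th coefficient of the orthogonal projection of `F|strip` onto `1`-periodic holomorphic
`q`-series for the weight-`k` strip measure `y^{k-2} dx dy` on `Γ_∞\ℍ = [0,1] × (0,∞)`. -/
def stripCoeff (k : ℕ) (φ g : UpperHalfPlane → ℂ) (m : ℕ) : ℂ :=
  (((4 * Real.pi * (m : ℝ)) ^ (k - 1) / Real.Gamma ((k : ℝ) - 1) : ℝ) : ℂ) *
    ∫ y in Set.Ioi (0 : ℝ),
      (∫ x in (0 : ℝ)..1,
          φ (UpperHalfPlane.ofComplex ((x : ℂ) + (y : ℂ) * Complex.I)) *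
            g (UpperHalfPlane.ofComplex ((x : ℂ) + (y : ℂ) * Complex.I)) *
            Complex.exp (-(2 * Real.pi * Complex.I * (m : ℂ) * (x : ℂ)))) *
        ((Real.exp (-(2 * Real.pi * (m : ℝ) * y)) * y ^ ((k : ℝ) - 2) : ℝ) : ℂ)

/-- The BEREZIN TRANSFORM at level `k` (probability normalisation on `(ℍ, dx dy / y²)`):
`B_k φ (z₀) = (k-1)/(4π) ∫_ℍ cosh(d(z,z₀)/2)^{-2k} φ(z) dμ(z)` — verbatim the expression inside the route's
support item `BerezinLocalization` (`berezinLocalization_iff` is `Iff.rfl`). -/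
def berezin (k : ℕ) (φ : UpperHalfPlane → ℂ) (z₀ : UpperHalfPlane) : ℂ :=
  ((((k : ℝ) - 1) / (4 * Real.pi) : ℝ) : ℂ) *
    ∫ z : UpperHalfPlane, (((Real.cosh (dist z z₀ / 2)) ^ (-(2 * (k : ℝ))) : ℝ) : ℂ) * φ z

/-- The route's support item `BerezinLocalization` (stmt-Langlands-11635) over `berezin` (definitional). -/
theorem berezinLocalization_iff : BerezinLocalization ↔
    ∀ (φ : UpperHalfPlane → ℂ) (C A : ℝ), Continuous φ →
      (∀ z : UpperHalfPlane, ‖φ z‖ ≤ C * (z.im ^ A + z.im ^ (-A))) →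
        ∀ z₀ : UpperHalfPlane, Filter.Tendsto (fun k : ℕ => berezin k φ z₀) Filter.atTop (nhds (φ z₀)) :=
  Iff.rfl

/-- ADMISSIBLE SYMBOL with constants `(C, A)`: continuous on `ℍ`, `1`-periodic (`φ(Tz) = φ(z)`), and of
two-sided polynomial growth `‖φ(z)‖ ≤ C (y^A + y^{-A})` — the only properties of the Maass lift the
Berezin argument uses. -/
@[folklore] def IsSymbol (φ : UpperHalfPlane → ℂ) (C A : ℝ) : Prop :=
  Continuous φ ∧ (∀ z : UpperHalfPlane, φ (ModularGroup.T • z) = φ z) ∧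
    ∀ z : UpperHalfPlane, ‖φ z‖ ≤ C * (z.im ^ A + z.im ^ (-A))

/-- FREE POINT of `Γ₀(L)`: every element of `Γ₀(L)` fixing `z` acts trivially on `ℍ` (i.e. is `±1`);
equivalently `z` is not an elliptic fixed point of `Γ₀(L)`. -/
@[folklore] def IsFreePoint (L : ℕ) (z : UpperHalfPlane) : Prop :=
  ∀ γ ∈ CongruenceSubgroup.Gamma0 L, γ • z = z → ∀ w : UpperHalfPlane, γ • w = w

/-- STRIP-SHADOW MODULARITY of a symbol `φ` from weight `k₀` on: for every `k ≥ k₀` and every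
`g ∈ S_k(Γ₀(L), ψ)` (four-clause sense) the strip projection `P_k(φ g) = Σ_{m≥1} P_k(φ,g)_m q^m`
converges and is a cusp form in `S_k(Γ₀(L), χψ)`. For `φ = φ_(a,ε)` and `k` large this is exactly the
shadow hypothesis of the crux (`stub_shadowCoeff_eq_stripCoeff`). -/
@[folklore] def StripShadowsModular (N L : ℕ) (χ : DirichletCharacter ℂ N) (ψ : DirichletCharacter ℂ L)
    (φ : UpperHalfPlane → ℂ) (k₀ : ℕ) : Prop :=
  ∀ k : ℕ, k₀ ≤ k → ∀ (b : ℕ → ℂ) (g : UpperHalfPlane → ℂ),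
    IsCusp k L (fun d : ℤ => ψ (d : ZMod L)) g b →
      ∃ c : ℕ → ℂ, (∀ m : ℕ, 1 ≤ m → c m = stripCoeff k φ g m) ∧
        IsCusp k L (fun d : ℤ => χ (d : ZMod N) * ψ (d : ZMod L)) (qSeries c) c

/-! ## 2. The stubs (the ONLY sorries of this file) -/

/-- **STUB 1 — the Maass lift is an admissible symbol** (M/L; true analysis). For `‖a_n‖ ≤ C(n+1)^A`
and any `ε`, `φ_(a,ε)` is continuous, `1`-periodic and `‖φ_(a,ε)(z)‖ ≤ C'(y^{A'} + y^{-A'})`.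
Proof route: `cosh t ≥ 1 + t²/2` gives `0 ≤ K₀(x) ≤ e^{-x} √(π/(2x))`, so the `n`-th term is
`≪ (n+2)^A e^{-2π(n+1)y}/√(n+1)`, locally uniformly summable on `ℍ` (continuity of each term: dominated
convergence for the parametric integral `K₀`), with sum `≪ y^{-A-1}` as `y → 0` and `≪ e^{-2πy}` as
`y → ∞`; periodicity is termwise (`(T•z).re = z.re + 1`, `(T•z).im = z.im`). [cite: Iwaniec2002, §1.9 and Thm 3.1] -/
theorem stub_maassLiftSymbol (a : ℕ → ℂ) (ε : ℂ) (C A : ℝ)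
    (ha : ∀ n : ℕ, ‖a n‖ ≤ C * ((n : ℝ) + 1) ^ A) :
    ∃ C' A' : ℝ, IsSymbol (maass a ε) C' A' := by
  sorry

/-- **STUB 2 — Sturm–Lipschitz unfolding: the typed shadow coefficients ARE the strip-projection
coefficients of `F = φ_(a,ε)·g`** (L; true analysis, the computation behind the route's `coeff`). For
`‖a_n‖ ≤ C(n+1)^A` there is a weight `k₁ = k₁(A)` such that for every `k ≥ k₁`, every `g = Σ b_m q^m`
in the four-clause class (any level `L`, any multiplier `ω`; only the `q`-expansion, continuity and the bound
`y^{k/2}|g| ≤ C_g`, hence Hecke's `|b_m| ≤ C_g e^{2π} m^{k/2}`, are used) and every `m ≥ 1`: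
`coeff a ε k b m = P_k(φ_(a,ε), g)_m`. Proof route: expand `φ_(a,ε) g e^{-2πimx}` on the strip, the
`x`-integral picks `n + m' = m` (from `e(nx)`) and `m' - n = m` (from `ε e(-nx)`), the `y`-integral is `Ik k m m'`
(`√y · y^{k-2} = y^{k-3/2}`); Fubini/Tonelli is justified for `k > 2A + 6` by
`Σ_{n,m'} (n+1)^A m'^{k/2} Γ(k-1) (2π(n+m'+m))^{1-k} < ∞`. [cite: Sturm1980, Thm 1] [cite: GrossZagier1986, §IV.5] -/
theorem stub_shadowCoeff_eq_stripCoeff (a : ℕ → ℂ) (ε : ℂ) (C A : ℝ)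
    (ha : ∀ n : ℕ, ‖a n‖ ≤ C * ((n : ℝ) + 1) ^ A) :
    ∃ k₁ : ℕ, ∀ (k L : ℕ) (ω : ℤ → ℂ) (b : ℕ → ℂ) (g : UpperHalfPlane → ℂ), k₁ ≤ k →
      IsCusp k L ω g b → ∀ m : ℕ, 1 ≤ m → coeff a ε k b m = stripCoeff k (maass a ε) g m := by
  sorry

/-- **STUB 3 — the heart: exactly covariant symbols asymptotic to the Berezin transforms** (XL; the
route's bet in its natural generality — a Berezin–Toeplitz converse for `1`-periodic symbols of polynomial
growth). If the strip shadows of an admissible symbol `φ` against `S_k(Γ₀(L), ψ)` are cusp forms of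
character `χψ` for all `k ≥ k₀`, then along some sequence of weights `k_j → ∞` there are functions
`σ_j : ℍ → ℂ` that are EXACTLY `χ`-covariant under `Γ₀(L)` (`σ_j(γz) = χ(d_γ) σ_j(z)`) and satisfy
`σ_j(z) - B_{k_j} φ(z) → 0` at every FREE point `z`. Intended witness: `k_j` in the parity class of `ψ`,
`σ_j(z) = (A_k K^ψ_z)(z) / K^ψ_z(z)` the normalised covariant symbol of the shadow operator
`A_k : S_k(L,ψ) → S_k(L,χψ)`, `g ↦ P_k(φ g)` (`K^ψ_z` = Bergman–Petersson kernel of `S_k(Γ₀(L),ψ)`, `0/0 = 0`):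
covariance is exact algebra for ANY operator between the two spaces; `⟨A_k g, P_m⟩ = ∫_strip φ g ē_m y^k dμ`
(Poincaré-series unfolding, no automorphy of `φ` needed) expresses `σ_j` through the `Γ_∞`-periodised Bergman
seed, whose identity-coset term is `B_k φ` (periodicity of `φ` unfolds the strip to `ℍ`) and whose
off-diagonal `Γ_∞\Γ₀(L)` terms must be shown `→ 0` at free points — THE RISK (route why-might-fail: not
uniform for `y ≳ √k`, Auvray–Ma–Marinescu; pointwise is what is claimed). At elliptic points the stabiliser
contributes extra main terms, hence the restriction to free points (closed up by stubs 4–5 in the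
composition). [cite: Radulescu1998, Introduction pp. 8, 19] [cite: Sturm1980, Thm 1] [cite: Iwaniec2002, Ch. 3] -/
theorem stub_covariantSymbol (N L : ℕ) (χ : DirichletCharacter ℂ N) (ψ : DirichletCharacter ℂ L)
    (φ : UpperHalfPlane → ℂ) (C A : ℝ) (k₀ : ℕ) (hN : 0 < N) (hNL : N ∣ L) (hL : 0 < L)
    (hφ : IsSymbol φ C A) (hmod : StripShadowsModular N L χ ψ φ k₀) :
    ∃ (ks : ℕ → ℕ) (σ : ℕ → UpperHalfPlane → ℂ), Filter.Tendsto ks Filter.atTop Filter.atTop ∧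
      (∀ j : ℕ, ∀ γ ∈ CongruenceSubgroup.Gamma0 L, ∀ z : UpperHalfPlane,
        σ j (γ • z) = χ ((((γ : Matrix (Fin 2) (Fin 2) ℤ) 1 1 : ℤ) : ZMod N)) * σ j z) ∧
      ∀ z : UpperHalfPlane, IsFreePoint L z →
        Filter.Tendsto (fun j : ℕ => σ j z - berezin (ks j) φ z) Filter.atTop (nhds 0) := by
  sorry

/-- **STUB 4 — Berezin localisation** = the route's support item `BerezinLocalization`
(stmt-Langlands-11635, provable now over Mathlib's measure `dx dy/y²` and hyperbolic `dist` on `ℍ`), cited BY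
NAME: `B_k φ(z₀) → φ(z₀)` as `k → ∞` for continuous `φ` with `‖φ(z)‖ ≤ C(y^A + y^{-A})` (the kernel
`(k-1)/(4π) cosh(d/2)^{-2k}` has mass `1` and concentrates at rate `k^{-1/2}`; its tail beats `e^{A d}`).
[cite: Radulescu1998, Introduction] -/
theorem stub_berezinLocalization : BerezinLocalization := by
  sorry

/-- **STUB 5 — free points are dense** (M; hyperbolic geometry of `Γ₀(L) ≤ SL₂(ℤ)`): the points of `ℍ`
whose stabiliser in `Γ₀(L)` acts trivially form a dense set — each of the countably many `γ ≠ ±1` fixes at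
most one point of `ℍ` (`UpperHalfPlane.gl_smul_eq_self_iff_eq_fixedPt`,
`forall_smul_eq_self_iff_mem_center`), and the complement of a countable subset of `ℍ` is dense.
[cite: Iwaniec2002, §2.3] -/
theorem stub_freePointsDense (L : ℕ) : Dense {z : UpperHalfPlane | IsFreePoint L z} := by
  sorry

/-! ## 3. The stub statements as named propositions (hypotheses of the composition, by name) -/

namespace _Goal

/-- The statement of `stub_maassLiftSymbol` (literally its type). -/
@[folklore] def stub_maassLiftSymbol : Prop :=
  type_of% @Summit.Langlands.Langlands.Cruxes.ShadowConverse.Birth.stub_maassLiftSymbol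

/-- The statement of `stub_shadowCoeff_eq_stripCoeff` (literally its type). -/
@[folklore] def stub_shadowCoeff_eq_stripCoeff : Prop :=
  type_of% @Summit.Langlands.Langlands.Cruxes.ShadowConverse.Birth.stub_shadowCoeff_eq_stripCoeff

/-- The statement of `stub_covariantSymbol` (literally its type). -/
@[folklore] def stub_covariantSymbol : Prop :=
  type_of% @Summit.Langlands.Langlands.Cruxes.ShadowConverse.Birth.stub_covariantSymbol

/-- The statement of `stub_berezinLocalization` (literally its type, i.e. `BerezinLocalization`). -/
@[folklore] def stub_berezinLocalization : Prop :=
  type_of% @Summit.Langlands.Langlands.Cruxes.ShadowConverse.Birth.stub_berezinLocalization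

/-- The statement of `stub_freePointsDense` (literally its type). -/
@[folklore] def stub_freePointsDense : Prop :=
  type_of% @Summit.Langlands.Langlands.Cruxes.ShadowConverse.Birth.stub_freePointsDense

end _Goal

/-! ## 4. Composition (kernel-checked, no `sorry`): STUBS 1–5 ⟹ `ShadowConverse` BY NAME -/

/-- Free points are permuted by `Γ₀(L)` (conjugation of stabilisers). -/
theorem isFreePoint_smul {L : ℕ} {γ : Matrix.SpecialLinearGroup (Fin 2) ℤ}
    (hγ : γ ∈ CongruenceSubgroup.Gamma0 L) {z : UpperHalfPlane} (hz : IsFreePoint L z) :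
    IsFreePoint L (γ • z) := by
  intro δ hδ hfix w
  have hmem : γ⁻¹ * δ * γ ∈ CongruenceSubgroup.Gamma0 L := mul_mem (mul_mem (inv_mem hγ) hδ) hγ
  have hfz : (γ⁻¹ * δ * γ) • z = z := by
    rw [mul_smul, mul_smul, hfix, inv_smul_smul]
  have h := hz _ hmem hfz (γ⁻¹ • w)
  rw [mul_smul, mul_smul, smul_inv_smul] at h
  -- h : γ⁻¹ • δ • w = γ⁻¹ • w
  exact (smul_left_cancel_iff γ⁻¹).mp h

/-- **`ShadowConverse` from the five stubs.** Fix the data of the crux and put `φ = φ_(a,ε)`. STUB 1 makes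
`φ` an admissible symbol; STUB 2 (from weight `k₁` on) identifies the crux's shadow `Σ c_m q^m` with the strip
projection `P_k(φ g)`, so the crux hypothesis (from `k₀` on) is strip-shadow modularity of `φ` from
`max k₀ k₁` on; STUB 3 yields exactly `χ`-covariant `σ_j` with `σ_j - B_{k_j}φ → 0` at free points; STUB 4
gives `B_{k_j} φ → φ` pointwise; uniqueness of limits gives `φ(γz) = χ(d_γ) φ(z)` at every free `z`
(free points are `Γ₀(L)`-stable), and STUB 5 + continuity of `φ` and of `z ↦ γ•z` extend it to all of `ℍ`. -/
theorem ShadowConverse_of (h₁ : _Goal.stub_maassLiftSymbol) (h₂ : _Goal.stub_shadowCoeff_eq_stripCoeff)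
    (h₃ : _Goal.stub_covariantSymbol) (h₄ : _Goal.stub_berezinLocalization)
    (h₅ : _Goal.stub_freePointsDense) : ShadowConverse := by
  have H₁ : ∀ (a : ℕ → ℂ) (ε : ℂ) (C A : ℝ), (∀ n : ℕ, ‖a n‖ ≤ C * ((n : ℝ) + 1) ^ A) →
      ∃ C' A' : ℝ, IsSymbol (maass a ε) C' A' := h₁
  have H₂ : ∀ (a : ℕ → ℂ) (ε : ℂ) (C A : ℝ), (∀ n : ℕ, ‖a n‖ ≤ C * ((n : ℝ) + 1) ^ A) →
      ∃ k₁ : ℕ, ∀ (k L : ℕ) (ω : ℤ → ℂ) (b : ℕ → ℂ) (g : UpperHalfPlane → ℂ), k₁ ≤ k →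
        IsCusp k L ω g b → ∀ m : ℕ, 1 ≤ m → coeff a ε k b m = stripCoeff k (maass a ε) g m := h₂
  have H₃ : ∀ (N L : ℕ) (χ : DirichletCharacter ℂ N) (ψ : DirichletCharacter ℂ L)
      (φ : UpperHalfPlane → ℂ) (C A : ℝ) (k₀ : ℕ), 0 < N → N ∣ L → 0 < L →
      IsSymbol φ C A → StripShadowsModular N L χ ψ φ k₀ →
      ∃ (ks : ℕ → ℕ) (σ : ℕ → UpperHalfPlane → ℂ), Filter.Tendsto ks Filter.atTop Filter.atTop ∧
        (∀ j : ℕ, ∀ γ ∈ CongruenceSubgroup.Gamma0 L, ∀ z : UpperHalfPlane,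
          σ j (γ • z) = χ ((((γ : Matrix (Fin 2) (Fin 2) ℤ) 1 1 : ℤ) : ZMod N)) * σ j z) ∧
        ∀ z : UpperHalfPlane, IsFreePoint L z →
          Filter.Tendsto (fun j : ℕ => σ j z - berezin (ks j) φ z) Filter.atTop (nhds 0) := h₃
  have H₄ : ∀ (φ : UpperHalfPlane → ℂ) (C A : ℝ), Continuous φ →
      (∀ z : UpperHalfPlane, ‖φ z‖ ≤ C * (z.im ^ A + z.im ^ (-A))) →
        ∀ z₀ : UpperHalfPlane, Filter.Tendsto (fun k : ℕ => berezin k φ z₀) Filter.atTop (nhds (φ z₀)) :=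
    berezinLocalization_iff.mp h₄
  have H₅ : ∀ L : ℕ, Dense {z : UpperHalfPlane | IsFreePoint L z} := h₅
  rw [shadowConverse_iff]
  intro N L χ ψ ε a k₀ hN hNL hL _hε hgrowth hshadow γ hγ z
  obtain ⟨C, A, ha⟩ := hgrowth
  -- STUB 1: φ = maass a ε is an admissible symbol
  obtain ⟨C', A', hsymb⟩ := H₁ a ε C A ha
  have hcont : Continuous (maass a ε) := hsymb.1
  have hbound : ∀ z : UpperHalfPlane, ‖maass a ε z‖ ≤ C' * (z.im ^ A' + z.im ^ (-A')) := hsymb.2.2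
  -- STUB 2: the shadow coefficients are the strip-projection coefficients from weight k₁ on
  obtain ⟨k₁, hk₁⟩ := H₂ a ε C A ha
  -- the crux hypothesis becomes strip-shadow modularity of φ from weight max k₀ k₁ on
  have hmod : StripShadowsModular N L χ ψ (maass a ε) (max k₀ k₁) := by
    intro k hk b g hg
    refine ⟨coeff a ε k b, fun m hm => hk₁ k L _ b g (le_of_max_le_right hk) hg m hm, ?_⟩
    exact (hshadow k (le_of_max_le_left hk) b g hg).2
  -- STUB 3: exactly covariant symbols asymptotic to the Berezin transforms at free points
  obtain ⟨ks, σ, hks, hcov, hconv⟩ := H₃ N L χ ψ (maass a ε) C' A' (max k₀ k₁) hN hNL hL hsymb hmod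
  -- STUB 4: Berezin localisation for φ
  have hloc := H₄ (maass a ε) C' A' hcont hbound
  set χd : ℂ := (χ ((((γ : Matrix (Fin 2) (Fin 2) ℤ) 1 1 : ℤ) : ZMod N)) : ℂ) with hχd
  -- the identity at every free point
  have hfree : ∀ w : UpperHalfPlane, IsFreePoint L w → maass a ε (γ • w) = χd * maass a ε w := by
    intro w hw
    have hw' : IsFreePoint L (γ • w) := isFreePoint_smul hγ hw
    have t1 : Filter.Tendsto (fun j : ℕ => berezin (ks j) (maass a ε) w) Filter.atTop
        (nhds (maass a ε w)) := (hloc w).comp hks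
    have t2 : Filter.Tendsto (fun j : ℕ => berezin (ks j) (maass a ε) (γ • w)) Filter.atTop
        (nhds (maass a ε (γ • w))) := (hloc (γ • w)).comp hks
    have t3 := hconv w hw
    have t4 := hconv (γ • w) hw'
    have t5 : Filter.Tendsto (fun j : ℕ => berezin (ks j) (maass a ε) (γ • w) - χd * berezin (ks j) (maass a ε) w)
        Filter.atTop (nhds (maass a ε (γ • w) - χd * maass a ε w)) := t2.sub (t1.const_mul χd)
    have t6 : Filter.Tendsto (fun j : ℕ => berezin (ks j) (maass a ε) (γ • w) - χd * berezin (ks j) (maass a ε) w)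
        Filter.atTop (nhds 0) := by
      have e : (fun j : ℕ => berezin (ks j) (maass a ε) (γ • w) - χd * berezin (ks j) (maass a ε) w) =
          fun j : ℕ => -(σ j (γ • w) - berezin (ks j) (maass a ε) (γ • w)) +
            χd * (σ j w - berezin (ks j) (maass a ε) w) := by
        funext j
        rw [hcov j γ hγ w]
        ring
      rw [e]
      simpa using t4.neg.add (t3.const_mul χd)
    exact sub_eq_zero.mp (tendsto_nhds_unique t5 t6)
  -- STUB 5 + continuity: extend from the dense set of free points to all of ℍ
  have hγc : Continuous fun w : UpperHalfPlane => γ • w := by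
    simp only [ModularGroup.sl_moeb]
    exact continuous_const_smul _
  have hclosed : IsClosed {w : UpperHalfPlane | maass a ε (γ • w) = χd * maass a ε w} :=
    isClosed_eq (hcont.comp hγc) (continuous_const.mul hcont)
  have hsub : {w : UpperHalfPlane | IsFreePoint L w} ⊆
      {w : UpperHalfPlane | maass a ε (γ • w) = χd * maass a ε w} := fun w hw => hfree w hw
  have hz : z ∈ closure {w : UpperHalfPlane | maass a ε (γ • w) = χd * maass a ε w} := by
    rw [((H₅ L).mono hsub).closure_eq]
    exact Set.mem_univ z
  rw [hclosed.closure_eq] at hz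
  exact hz

/-- By-name sanity check (an `example`, not a declaration): the five stubs feed the composition. -/
example : ShadowConverse :=
  ShadowConverse_of stub_maassLiftSymbol stub_shadowCoeff_eq_stripCoeff stub_covariantSymbol
    stub_berezinLocalization stub_freePointsDense

end Summit.Langlands.Langlands.Cruxes.ShadowConverse.Birth

end
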